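import Summits.Ventures.PercRepro.RankLevelSetLevelSixT13Cell7
import Summits.Ventures.PercRepro.RankLevelSetLevelSixT13Cell8
import Summits.Ventures.PercRepro.RankLevelSetLevelSixT13Cell9
import Summits.Ventures.PercRepro.RankLevelSetLevelSixT13Cell10
import Summits.Ventures.PercRepro.RankLevelSetLevelSixT13Cell11
import Summits.Ventures.PercRepro.RankLevelSetLevelSixT13Cell12
import Summits.Ventures.PercRepro.RankLevelSetLevelSixT13Cell13
import Summits.Ventures.PercRepro.RankLevelSetLevelSixT13Cell14
import Summits.Ventures.PercRepro.RankLevelSetLevelSixT13Cell15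
import Summits.Ventures.PercRepro.RankLevelSetLevelSixT13Cell16
import Summits.Ventures.PercRepro.RankLevelSetLevelSixT13Cell17
import Summits.Ventures.PercRepro.RankLevelSetLevelSixT13Cell18
import Summits.Ventures.PercRepro.RankLevelSetLevelSixT13Cell19
import Summits.Ventures.PercRepro.RankLevelSetLevelSixT13Cell20
import Summits.Ventures.PercRepro.RankLevelSetLevelSixT13Cell21
import Summits.Ventures.PercRepro.RankLevelSetLevelSixT13Cell22
import Summits.Ventures.PercRepro.RankLevelSetLevelSixT13Cell23
import Summits.Ventures.PercRepro.RankLevelSetLevelSixT13Cell24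
import Summits.Ventures.PercRepro.RankLevelSetLevelSixT13Cell25
import Summits.Ventures.PercRepro.RankLevelSetLevelSixT13Cell26
import Summits.Ventures.PercRepro.RankLevelSetLevelSixT13Cell27
import Summits.Ventures.PercRepro.RankLevelSetLevelSixT13Cell28
import Summits.Ventures.PercRepro.RankLevelSetLevelSixT13Cell29
import Summits.Ventures.PercRepro.RankLevelSetLevelSixT13Cell30
import Summits.Ventures.PercRepro.RankLevelSetLevelSixT13Cell31
import Summits.Ventures.PercRepro.RankLevelSetLevelSixT13Cell32
import Summits.Ventures.PercRepro.RankLevelSetLevelSixT13Cell33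
import Summits.Ventures.PercRepro.RankLevelSetLevelSixT13Cell34
import Summits.Ventures.PercRepro.RankLevelSetLevelSixT13Cell35
import Summits.Ventures.PercRepro.RankLevelSetLevelSixT13Cell36
import Summits.Ventures.PercRepro.S3MidKeyThirteen
import Summits.Ventures.PercRepro.S3SixWindow
import Summits.Ventures.PercRepro.RankLevelSetLevelFiveLadder

/-!
# PercRepro — THE 13 ROW'S CORE: `c025_core_six_thirteen (d ≥ 7) : RLS M 13 6` — EVERY `e`-FREE CORE OF RANK `13` AT LEVEL `6`, AND THE
ROW 13 GIVEN THE ROW 14 (p7 g22, S3 feeder; p8's assembly shape; tools/gen_rowP.py)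

The core cells `(13, d)`: `7 ≤ d ≤ 36` by the coloop device with the lossy ladder on the natural cells of the rows `13 − k`
(`c025_core_six_thirteen_<d>`), `d ≥ 37` by the middle key (`S3Mid.c025_core_six_midkey_thirteen`, no coloop-freeness needed). Then the
level-5 glue `rls_six_at_of_core 13` on `c025_five_all` (level `5` at `p = 12`) gives level `6` at `p = 13`; with the 14 row
this is the 13 row: **`c025_six_large_thirteen_of_fourteen`**.
Axioms: standard.
-/

open scoped Matroid

namespace PercRepro

namespace ThmN

variable {α : Type}

/-- **The core cell `(13, d)` at every corank `d ≥ 7`, every `e`-free core.** -/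
theorem c025_core_six_thirteen (M : Matroid α) [M.Finite] (d : ℕ) (hd7 : 7 ≤ d)
    (hR : M.eRank = (13 : ℕ∞)) (hn : M.E.ncard = 13 + d)
    (hfree : ∀ e ∈ M.E, ∃ A ⊆ M.E \ {e}, e ∉ M.closure A ∧ e ∉ M.closure ((M.E \ {e}) \ A)) :
    RLS M 13 6 := by
  rcases Nat.lt_or_ge d 37 with hlt | hge
  · interval_cases d
    · exact c025_core_six_thirteen_7 M hR hn hfree
    · exact c025_core_six_thirteen_8 M hR hn hfree
    · exact c025_core_six_thirteen_9 M hR hn hfree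
    · exact c025_core_six_thirteen_10 M hR hn hfree
    · exact c025_core_six_thirteen_11 M hR hn hfree
    · exact c025_core_six_thirteen_12 M hR hn hfree
    · exact c025_core_six_thirteen_13 M hR hn hfree
    · exact c025_core_six_thirteen_14 M hR hn hfree
    · exact c025_core_six_thirteen_15 M hR hn hfree
    · exact c025_core_six_thirteen_16 M hR hn hfree
    · exact c025_core_six_thirteen_17 M hR hn hfree
    · exact c025_core_six_thirteen_18 M hR hn hfree
    · exact c025_core_six_thirteen_19 M hR hn hfree
    · exact c025_core_six_thirteen_20 M hR hn hfree
    · exact c025_core_six_thirteen_21 M hR hn hfree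
    · exact c025_core_six_thirteen_22 M hR hn hfree
    · exact c025_core_six_thirteen_23 M hR hn hfree
    · exact c025_core_six_thirteen_24 M hR hn hfree
    · exact c025_core_six_thirteen_25 M hR hn hfree
    · exact c025_core_six_thirteen_26 M hR hn hfree
    · exact c025_core_six_thirteen_27 M hR hn hfree
    · exact c025_core_six_thirteen_28 M hR hn hfree
    · exact c025_core_six_thirteen_29 M hR hn hfree
    · exact c025_core_six_thirteen_30 M hR hn hfree
    · exact c025_core_six_thirteen_31 M hR hn hfree
    · exact c025_core_six_thirteen_32 M hR hn hfree
    · exact c025_core_six_thirteen_33 M hR hn hfree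
    · exact c025_core_six_thirteen_34 M hR hn hfree
    · exact c025_core_six_thirteen_35 M hR hn hfree
    · exact c025_core_six_thirteen_36 M hR hn hfree
  · exact S3Mid.c025_core_six_midkey_thirteen M d hge hR hn hfree

/-- **THEOREM C₆ AT RANK `13`**: level `6` at `p = 13` for every finite matroid (on level `5` at `p = 12`, `c025_five_all`). -/
theorem c025_six_at_thirteen (M : Matroid α) [M.Finite] : RLS M 13 6 :=
  rls_six_at_of_core 13 (by norm_num) (fun M _ => c025_five_all M 12 (by norm_num))
    (fun M _ d hd hR hn hfree => c025_core_six_thirteen M d hd hR hn hfree) M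

/-- **THE 13 ROW GIVEN THE 14 ROW**: C-025 at level `6` for every `p ≥ 13`, every finite matroid, from the 14 row. -/
theorem c025_six_large_thirteen_of_fourteen (h : ∀ (M : Matroid α) [M.Finite] (p : ℕ), 14 ≤ p → RLS M p 6)
    (M : Matroid α) [M.Finite] (p : ℕ) (hp : 13 ≤ p) : RLS M p 6 := by
  rcases Nat.lt_or_ge p 14 with hlt | hge
  · have hP : p = 13 := by omega
    subst hP
    exact c025_six_at_thirteen M
  · exact h M p hge

end ThmN

end PercRepro
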